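import Summits.Ventures.AbcSig.Rows.Bridge
import Summits.Ventures.AbcSig.Rows.C2aL317A45
import Summits.Ventures.AbcSig.Rows.C2aL317A45AB

/-!
# Venture AbcSig — CELL `C2aL317A45`: the census statement `Rows.C2aCellRed 317 (fun a => a = 4 ∨ a = 5) ∅` from the two row theorems

HONEST FRAMING. COMPUTATION cell `pub-abcsig`; CONDITIONAL theorem; no claim on ABC or any summit. Hypotheses exactly as
in `Rows/C2aL317A45.lean` and `Rows/C2aL317A45AB.lean`: `BS04Package` (CITED), `DataComplete …` (COMPUTED level files), and the
rows' per-orbit exclusions for BOTH family predicates (`famB`, `famAB`) as universally quantified hypotheses (CITED: the census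
row's certificates). Conclusion = p1's census predicate (`Rows/Statements.lean`), all four coprime coefficient
distributions `A·B = 2^a·317^m`, reduced exponents `a < n`, `m < n` (RULING H1). GENERATED by p-lean g2 gen/make_rows.py
(after plean/make_cell_bridges.py).
-/

namespace Summit.Ventures.AbcSig

/-- Cell `C2aL317A45`: `Rows.C2aCellRed 317 (fun a => a = 4 ∨ a = 5) ∅` under the rows' hypotheses. -/
theorem cell_C2aL317A45 (M : NewformModel) (hP : M.BS04Package)
    (hD634 : M.DataComplete 634 level634Orbits)
    (hD2536 : M.DataComplete 2536 level2536Orbits)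
    (hX_orbit_634_4 : ∀ n a m : ℕ, n ∈ ([53] : List ℕ) → M.Excludes 634 orbit_634_4 (famB (2 ^ a * 317 ^ m) n (fun _ _ => True)))
    (hX_orbit_634_4' : ∀ n a m : ℕ, n ∈ ([53] : List ℕ) → M.Excludes 634 orbit_634_4 (famAB (317 ^ m) (2 ^ a) n (fun _ _ => True)))
    (hX_orbit_2536_3 : ∀ n a m : ℕ, n ∈ ([7, 11] : List ℕ) → M.Excludes 2536 orbit_2536_3 (famB (2 ^ a * 317 ^ m) n (fun _ _ => True)))
    (hX_orbit_2536_3' : ∀ n a m : ℕ, n ∈ ([7, 11] : List ℕ) → M.Excludes 2536 orbit_2536_3 (famAB (317 ^ m) (2 ^ a) n (fun _ _ => True))) :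
    Rows.C2aCellRed 317 (fun a => a = 4 ∨ a = 5) ∅ :=
  C2aCellRed_of_rows 317 (by norm_num) (by norm_num) _ _
    (fun n hn h11 hnℓ _ a m ha han hm hmn x y z h1 h2 =>
      row_C2aL317A45 M hP hD634 hD2536 n hn h11 hnℓ a m ha hm han hmn (hX_orbit_634_4 n a m) (hX_orbit_2536_3 n a m) x y z h1 h2)
    (fun n hn h11 hnℓ _ a m ha han hm hmn x y z h1 h2 =>
      row_C2aL317A45AB M hP hD634 hD2536 n hn h11 hnℓ a m ha hm han hmn (hX_orbit_634_4' n a m) (hX_orbit_2536_3' n a m) x y z h1 h2)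

end Summit.Ventures.AbcSig
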